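import Mathlib.Topology.ContinuousMap.StoneWeierstrass
import Mathlib.Analysis.InnerProductSpace.PiL2
import Mathlib.Analysis.Calculus.FDeriv.WithLp
import Mathlib.Analysis.Calculus.BumpFunction.Convolution
import Mathlib.Analysis.Calculus.BumpFunction.InnerProduct
import Mathlib.Analysis.Calculus.ContDiff.Convolution
import Mathlib.MeasureTheory.Measure.Haar.Unique
import Mathlib.MeasureTheory.Group.Integral
import Mathlib.MeasureTheory.Measure.Lebesgue.EqHaar
import Literature.NumberTheory.Transcendental.AnalytificationImplicit
import HarnessLib

/-!
# Weierstrass approximation with first derivatives on compact subsets of `ℝⁿ`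

Topic `Literature/Topology/FourManifolds` (first rung of the proof of the named fact
`Literature.Topology.FourManifolds.Seifert1936_algebraicModel`, `SeifertAlgebraicModels.lean`:
Seifert's theorem that a compact smooth hypersurface of `ℝⁿ` is isotopic to a nonsingular real
algebraic hypersurface, after S. Akbulut, H. King, *Topology of Real Algebraic Sets*, MSRI Publ. 25
(1992), Ch. II, Thm. 2.8.2 with `V = ℝⁿ`).  **Everything in this file is proved; no named fact is
introduced.**

The algebraic half of the printed proof of Thm. 2.8.2 (PDF pp. 71–72 of the held copy) is its
**Lemma 2.8.1 (a)** (PDF p. 68): *a smooth `f : (V, P) → (ℝ, 0)` can be arbitrarily closely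
`C^∞`-approximated on a compact `K` by polynomials* — for `V = ℝⁿ` and `L = P = ∅` this is the
classical Weierstrass approximation theorem *with derivatives*, which the book takes as known
("now we may prove a) by approximating `uᵢ` on `K` by polynomials").  Mathlib has the
Stone–Weierstrass theorem (`C⁰` approximation by a point-separating subalgebra) but no statement
about polynomials in several variables and none about derivatives.  This file proves the order-one
case, which is what the transversality step of Thm. 2.8.2 consumes:

* `Literature.Topology.FourManifolds.exists_mvPolynomial_abs_sub_lt` — `C⁰` Weierstrass on a
  compact `K ⊆ ℝⁿ` for polynomials in `n` variables (Stone–Weierstrass applied to the range of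
  `MvPolynomial.aeval (coordinates)`, which separates points);
* `Literature.Topology.FourManifolds.exists_mvPolynomial_close_C1` (**main result**) — for a
  compactly supported `C¹` function `f` on `ℝⁿ`, a compact `K` and `ε > 0` there is a polynomial
  `p` with `|p - f| < ε` and `‖D p - D f‖ < ε` on `K`;
  `Literature.Topology.FourManifolds.exists_mvPolynomial_close_C1_of_contDiff` — the same for any
  `C¹` function (cut off outside a ball around `K`).

**Proof** (mollification; not the book's, which defers to the classical theorem). Let `ψ` be a
normed smooth bump of radius `δ`, `δ` a modulus of uniform continuity of `f` and `Df` for `ε/4`.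
Then `ψ ⋆ f` and `D(ψ ⋆ f) = ψ ⋆ Df` are `ε/4`-close to `f`, `Df` everywhere
(`ContDiffBump.dist_normed_convolution_le`, `HasCompactSupport.hasFDerivAt_convolution_right`).
Replace `ψ` by a polynomial `k` that is `η`-close to it on the ball `D` of radius `R_K + R_f`
containing every `t` with `x ∈ K`, `x - t ∈ supp f` (`C⁰` Weierstrass): on `K`,
`|k ⋆ f - ψ ⋆ f| ≤ η ‖f‖₁` and `‖k ⋆ Df - ψ ⋆ Df‖ ≤ η ‖Df‖₁`
(`dist_convolution_le_of_kernel`), and `k ⋆ f` *is* a polynomial function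
(`exists_mvPolynomial_convolution_eq`: substitute `t ↦ x - t` and expand `k(x - s)` as a polynomial
in `x` with coefficients polynomial in `s`, `exists_eval_sub_eq_sum`).

Also recorded, for the nonsingularity clause of Seifert's theorem: polynomial functions on
`EuclideanSpace ℝ (Fin n)` are smooth and their Fréchet derivative is given by the formal partial
derivatives `MvPolynomial.pderiv` (`hasFDerivAt_mvPolynomial_eval_ofLp`,
`fderiv_mvPolynomial_eval_ofLp_single`).

## References

* S. Akbulut, H. King, *Topology of Real Algebraic Sets*, MSRI Publ. 25, Springer (1992), Ch. II,
  Lemma 2.8.1 (a), Thm. 2.8.2. [AkbulutKing1992]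
* K. Weierstrass, *Über die analytische Darstellbarkeit sogenannter willkürlicher Functionen einer
  reellen Veränderlichen*, Sitzungsber. Akad. Berlin (1885). [Weierstrass1885]
-/

open scoped ContDiff Topology Convolution
open Function Set MvPolynomial MeasureTheory ContinuousLinearMap Metric

noncomputable section

namespace Literature.Topology.FourManifolds

variable {n : ℕ}

/-! ### Polynomial functions on `ℝⁿ`: smoothness and derivative -/

/-- A polynomial function `x ↦ p(x)` on `ℝⁿ = EuclideanSpace ℝ (Fin n)` is `C^N` for every `N`
(it is analytic, `AnalyticOnNhd.eval_continuousLinearMap`). [folklore] -/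
theorem contDiff_mvPolynomial_eval_ofLp (p : MvPolynomial (Fin n) ℝ) {N : WithTop ℕ∞} :
    ContDiff ℝ N (fun x : EuclideanSpace ℝ (Fin n) => eval (WithLp.ofLp x) p) := by
  have h := AnalyticOnNhd.eval_continuousLinearMap
    (PiLp.continuousLinearEquiv 2 ℝ (fun _ : Fin n => ℝ) :
      EuclideanSpace ℝ (Fin n) →L[ℝ] (Fin n → ℝ)) p
  exact h.contDiff

/-- **The derivative of a polynomial function is given by its partial derivatives**:
`D(p)(x) v = ∑ᵢ (∂p/∂xᵢ)(x) vᵢ` on `EuclideanSpace ℝ (Fin n)` (the tree's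
`Literature.NumberTheory.Transcendental.hasFDerivAt_eval` on `Fin n → ℝ`, composed with
`WithLp.ofLp`). [folklore] -/
theorem hasFDerivAt_mvPolynomial_eval_ofLp (p : MvPolynomial (Fin n) ℝ)
    (x : EuclideanSpace ℝ (Fin n)) :
    HasFDerivAt (fun y : EuclideanSpace ℝ (Fin n) => eval (WithLp.ofLp y) p)
      (∑ i, eval (WithLp.ofLp x) (pderiv i p) •
        (EuclideanSpace.proj i : EuclideanSpace ℝ (Fin n) →L[ℝ] ℝ)) x := by
  have h1 := Literature.NumberTheory.Transcendental.hasFDerivAt_eval p (WithLp.ofLp x)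
  have h2 := PiLp.hasFDerivAt_ofLp (𝕜 := ℝ) 2 x
  refine (h1.comp x h2).congr_fderiv ?_
  ext v
  simp

/-- The derivative of a polynomial function applied to a vector:
`D(p)(x) v = ∑ᵢ (∂p/∂xᵢ)(x) vᵢ`. [folklore] -/
theorem fderiv_mvPolynomial_eval_ofLp_apply (p : MvPolynomial (Fin n) ℝ)
    (x v : EuclideanSpace ℝ (Fin n)) :
    fderiv ℝ (fun y : EuclideanSpace ℝ (Fin n) => eval (WithLp.ofLp y) p) x v =
      ∑ i, eval (WithLp.ofLp x) (pderiv i p) * v i := by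
  rw [(hasFDerivAt_mvPolynomial_eval_ofLp p x).fderiv]
  simp

/-- The `i`-th partial derivative of a polynomial function is the value of the formal partial
derivative: `D(p)(x) eᵢ = (∂p/∂xᵢ)(x)`. [folklore] -/
theorem fderiv_mvPolynomial_eval_ofLp_single (p : MvPolynomial (Fin n) ℝ)
    (x : EuclideanSpace ℝ (Fin n)) (i : Fin n) :
    fderiv ℝ (fun y : EuclideanSpace ℝ (Fin n) => eval (WithLp.ofLp y) p) x
      (EuclideanSpace.single i 1) =
      eval (WithLp.ofLp x) (pderiv i p) := by
  classical
  rw [fderiv_mvPolynomial_eval_ofLp_apply]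
  simp [Finset.sum_ite_eq']

/-! ### `C⁰` Weierstrass approximation by polynomials in several variables -/

/-- **Weierstrass approximation on compact subsets of `ℝⁿ`** (`C⁰`): a continuous real function
is uniformly approximable on a compact `K ⊆ ℝⁿ` by polynomials in the `n` coordinates.
Stone–Weierstrass
(`ContinuousMap.exists_mem_subalgebra_near_continuous_of_isCompact_of_separatesPoints`)
for the range of `MvPolynomial.aeval (coordinate functions)`, which separates points.
[cite: AkbulutKing1992, Ch. II Lemma 2.8.1 (a) (V = ℝⁿ, L = P = ∅, order 0)] -/
theorem exists_mvPolynomial_abs_sub_lt {K : Set (EuclideanSpace ℝ (Fin n))} (hK : IsCompact K)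
    {f : EuclideanSpace ℝ (Fin n) → ℝ} (hf : Continuous f) {ε : ℝ} (hε : 0 < ε) :
    ∃ p : MvPolynomial (Fin n) ℝ, ∀ x ∈ K, |eval (WithLp.ofLp x) p - f x| < ε := by
  classical
  let c : Fin n → C(EuclideanSpace ℝ (Fin n), ℝ) := fun i => ⟨fun x => x i, by fun_prop⟩
  let A : Subalgebra ℝ C(EuclideanSpace ℝ (Fin n), ℝ) := (MvPolynomial.aeval c).range
  have hA : A.SeparatesPoints := by
    intro x y hxy
    obtain ⟨i, hi⟩ : ∃ i, x i ≠ y i := by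
      by_contra h
      push Not at h
      exact hxy (PiLp.ext h)
    exact ⟨c i, ⟨c i, (AlgHom.mem_range _).2 ⟨X i, MvPolynomial.aeval_X c i⟩, rfl⟩, hi⟩
  obtain ⟨g, hgA, hg⟩ :=
    ContinuousMap.exists_mem_subalgebra_near_continuous_of_isCompact_of_separatesPoints hA
      ⟨f, hf⟩ hK hε
  obtain ⟨p, rfl⟩ := (AlgHom.mem_range _).1 hgA
  refine ⟨p, fun x hx => ?_⟩
  have heval : (MvPolynomial.aeval c p : C(EuclideanSpace ℝ (Fin n), ℝ)) x =
      eval (WithLp.ofLp x) p := by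
    change ContinuousMap.evalAlgHom ℝ ℝ x (MvPolynomial.aeval c p) = _
    rw [MvPolynomial.comp_aeval_apply]
    rfl
  have := hg x hx
  rwa [heval, Real.norm_eq_abs] at this

/-! ### Convolution with a polynomial kernel is a polynomial -/

/-- **Expansion of a translated polynomial**: `k(a - b) = ∑_{m ∈ S} c_m(b) aᵐ` with polynomial
coefficients `c_m` (the coefficients of `k(X - Y) ∈ (ℝ[Y])[X]`). [folklore] -/
theorem exists_eval_sub_eq_sum (k : MvPolynomial (Fin n) ℝ) :
    ∃ (S : Finset (Fin n →₀ ℕ)) (c : (Fin n →₀ ℕ) → MvPolynomial (Fin n) ℝ),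
      ∀ a b : Fin n → ℝ, eval (a - b) k = ∑ m ∈ S, eval b (c m) * ∏ i, a i ^ m i := by
  classical
  let R := MvPolynomial (Fin n) ℝ
  let g : Fin n → MvPolynomial (Fin n) R := fun i => X i - C (X i : R)
  let Q : MvPolynomial (Fin n) R := aeval g k
  refine ⟨Q.support, Q.coeff, fun a b => ?_⟩
  have key : ∀ q : MvPolynomial (Fin n) ℝ, eval (a - b) q = eval₂ (eval b) a (aeval g q) := by
    intro q
    induction q using MvPolynomial.induction_on with
    | C r =>
      rw [MvPolynomial.aeval_C, MvPolynomial.algebraMap_apply, MvPolynomial.eval₂_C,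
        MvPolynomial.eval_C]
      exact (MvPolynomial.eval_C r).symm
    | add p q hp hq => rw [map_add, map_add, MvPolynomial.eval₂_add, hp, hq]
    | mul_X p i hp =>
      rw [map_mul, map_mul, MvPolynomial.eval₂_mul, ← hp, MvPolynomial.eval_X,
        MvPolynomial.aeval_X]
      simp [g]
  rw [key k, MvPolynomial.eval₂_eq']

/-- **The convolution of a polynomial kernel with a compactly supported continuous function is a
polynomial function**: `(k ⋆ f)(x) = ∫ k(t) f(x - t) dt = ∫ f(s) k(x - s) ds = p(x)` for the
polynomial `p = ∑ₘ (∫ f c_m) Xᵐ` of `exists_eval_sub_eq_sum`. [folklore] -/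
theorem exists_mvPolynomial_convolution_eq (k : MvPolynomial (Fin n) ℝ)
    {f : EuclideanSpace ℝ (Fin n) → ℝ} (hf : Continuous f) (hfc : HasCompactSupport f) :
    ∃ p : MvPolynomial (Fin n) ℝ, ∀ x : EuclideanSpace ℝ (Fin n),
      ((fun t : EuclideanSpace ℝ (Fin n) => eval (WithLp.ofLp t) k) ⋆[lsmul ℝ ℝ, volume] f) x =
        eval (WithLp.ofLp x) p := by
  classical
  obtain ⟨S, c, hS⟩ := exists_eval_sub_eq_sum k
  refine ⟨∑ m ∈ S, C (∫ s, f s * eval (WithLp.ofLp s) (c m)) * ∏ i, X i ^ m i, fun x => ?_⟩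
  have hcont : ∀ m, Continuous fun s : EuclideanSpace ℝ (Fin n) => eval (WithLp.ofLp s) (c m) :=
    fun m => (contDiff_mvPolynomial_eval_ofLp (c m) (N := 0)).continuous
  -- substitute `t ↦ x - t`
  have h1 :
      ((fun t : EuclideanSpace ℝ (Fin n) => eval (WithLp.ofLp t) k) ⋆[lsmul ℝ ℝ, volume] f) x =
        ∫ s, f s * eval (WithLp.ofLp x - WithLp.ofLp s) k := by
    rw [convolution_def, ← integral_sub_left_eq_self
      (fun s => f s * eval (WithLp.ofLp x - WithLp.ofLp s) k) volume x]
    refine integral_congr_ae (Filter.Eventually.of_forall fun t => ?_)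
    simp only [lsmul_apply, smul_eq_mul, sub_sub_cancel, ← WithLp.ofLp_sub, mul_comm]
  rw [h1]
  simp_rw [hS, Finset.mul_sum]
  rw [integral_finsetSum]
  · simp only [map_sum, map_mul, MvPolynomial.eval_C, map_prod, map_pow, MvPolynomial.eval_X]
    refine Finset.sum_congr rfl fun m _ => ?_
    rw [← integral_mul_const]
    refine integral_congr_ae (Filter.Eventually.of_forall fun s => ?_)
    simp only [mul_assoc]
  · intro m _
    have hc : Continuous fun s : EuclideanSpace ℝ (Fin n) =>
        f s * (eval (WithLp.ofLp s) (c m) * ∏ i, (WithLp.ofLp x) i ^ m i) :=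
      hf.mul ((hcont m).mul continuous_const)
    exact hc.integrable_of_hasCompactSupport hfc.mul_right

/-- **Changing the kernel where it matters.** If the real kernels `k₁, k₂` differ by at most `η`
at every `t` with `x - t` in a set `T ⊇ supp g` (`g` continuous with compact support), then
`‖(k₁ ⋆ g)(x) - (k₂ ⋆ g)(x)‖ ≤ η ∫ ‖g‖`. [folklore] -/
theorem dist_convolution_le_of_kernel {G' : Type*} [NormedAddCommGroup G'] [NormedSpace ℝ G']
    [CompleteSpace G'] {k₁ k₂ : EuclideanSpace ℝ (Fin n) → ℝ} (hk₁ : Continuous k₁)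
    (hk₂ : Continuous k₂) {g : EuclideanSpace ℝ (Fin n) → G'} (hg : Continuous g)
    (hgc : HasCompactSupport g) {T : Set (EuclideanSpace ℝ (Fin n))}
    (hT : support g ⊆ T) {x : EuclideanSpace ℝ (Fin n)} {η : ℝ}
    (hker : ∀ t, x - t ∈ T → |k₁ t - k₂ t| ≤ η) :
    dist ((k₁ ⋆[lsmul ℝ ℝ, volume] g) x) ((k₂ ⋆[lsmul ℝ ℝ, volume] g) x) ≤ η * ∫ t, ‖g t‖ := by
  have hgx : Continuous fun t : EuclideanSpace ℝ (Fin n) => g (x - t) :=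
    hg.comp (continuous_const.sub continuous_id)
  have hgxc : HasCompactSupport fun t : EuclideanSpace ℝ (Fin n) => g (x - t) :=
    hgc.comp_homeomorph (Homeomorph.subLeft x)
  have hint : ∀ {k : EuclideanSpace ℝ (Fin n) → ℝ}, Continuous k →
      Integrable (fun t => lsmul ℝ ℝ (k t) (g (x - t))) volume := by
    intro k hk
    have : (fun t => lsmul ℝ ℝ (k t) (g (x - t))) = k • fun t => g (x - t) := by
      ext t; simp
    rw [this]
    exact (hk.smul hgx).integrable_of_hasCompactSupport hgxc.smul_left
  rw [dist_eq_norm, convolution_def, convolution_def, ← integral_sub (hint hk₁) (hint hk₂)]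
  calc ‖∫ t, (lsmul ℝ ℝ (k₁ t) (g (x - t)) - lsmul ℝ ℝ (k₂ t) (g (x - t)))‖
      ≤ ∫ t, η * ‖g (x - t)‖ := by
        refine norm_integral_le_of_norm_le ((hgx.norm.const_mul η).integrable_of_hasCompactSupport
          (hgxc.norm.mul_left)) (Filter.Eventually.of_forall fun t => ?_)
        simp only [lsmul_apply, ← sub_smul, norm_smul, Real.norm_eq_abs]
        by_cases h : g (x - t) = 0
        · simp [h]
        · exact mul_le_mul_of_nonneg_right (hker t (hT (mem_support.2 h))) (norm_nonneg _)
    _ = η * ∫ t, ‖g (x - t)‖ := integral_const_mul _ _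
    _ = η * ∫ t, ‖g t‖ := by rw [integral_sub_left_eq_self (fun t => ‖g t‖) volume x]

/-- `(lsmul ℝ ℝ).precompR E = lsmul ℝ ℝ` on `E →L[ℝ] ℝ`-valued functions (the bilinear map in
`HasCompactSupport.hasFDerivAt_convolution_right` for `L = lsmul ℝ ℝ`). [folklore] -/
theorem precompR_lsmul_eq :
    ((lsmul ℝ ℝ).precompR (EuclideanSpace ℝ (Fin n)) :
      ℝ →L[ℝ] (EuclideanSpace ℝ (Fin n) →L[ℝ] ℝ) →L[ℝ] (EuclideanSpace ℝ (Fin n) →L[ℝ] ℝ)) =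
      lsmul ℝ ℝ := by
  ext c A
  simp

/-! ### `C¹` Weierstrass approximation -/

/-- **Weierstrass approximation with first derivatives, compactly supported case** (Akbulut–King,
Ch. II, Lemma 2.8.1 (a) for `V = ℝⁿ`, `L = P = ∅`, order `1`): for a compactly supported `C¹`
function `f : ℝⁿ → ℝ`, a compact `K ⊆ ℝⁿ` and `ε > 0` there is a polynomial `p` in the `n`
coordinates with `|p(x) - f(x)| < ε` and `‖Dp(x) - Df(x)‖ < ε` for all `x ∈ K`.
[cite: AkbulutKing1992, Ch. II Lemma 2.8.1 (a) (V = ℝⁿ, L = P = ∅, order 1)] -/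
theorem exists_mvPolynomial_close_C1 {f : EuclideanSpace ℝ (Fin n) → ℝ} (hf : ContDiff ℝ 1 f)
    (hfc : HasCompactSupport f) {K : Set (EuclideanSpace ℝ (Fin n))} (hK : IsCompact K) {ε : ℝ}
    (hε : 0 < ε) :
    ∃ p : MvPolynomial (Fin n) ℝ,
      (∀ x ∈ K, |eval (WithLp.ofLp x) p - f x| < ε) ∧
      ∀ x ∈ K, ‖fderiv ℝ (fun y : EuclideanSpace ℝ (Fin n) => eval (WithLp.ofLp y) p) x -
        fderiv ℝ f x‖ < ε := by
  classical
  -- Step A: uniform continuity of `f` and `Df`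
  set Df : EuclideanSpace ℝ (Fin n) → (EuclideanSpace ℝ (Fin n) →L[ℝ] ℝ) := fderiv ℝ f
    with hDf_def
  have hfcont : Continuous f := hf.continuous
  have hDfcont : Continuous Df := hf.continuous_fderiv one_ne_zero
  have hDfc : HasCompactSupport Df := hfc.fderiv ℝ
  have hε4 : 0 < ε / 4 := by positivity
  obtain ⟨δ₁, hδ₁, h₁⟩ := Metric.uniformContinuous_iff.1
    (hfc.uniformContinuous_of_continuous hfcont) (ε / 4) hε4
  obtain ⟨δ₂, hδ₂, h₂⟩ := Metric.uniformContinuous_iff.1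
    (hDfc.uniformContinuous_of_continuous hDfcont) (ε / 4) hε4
  have hδ : 0 < min δ₁ δ₂ := lt_min hδ₁ hδ₂
  -- Step B: the normed bump of radius `min δ₁ δ₂`
  let φ : ContDiffBump (0 : EuclideanSpace ℝ (Fin n)) :=
    ⟨min δ₁ δ₂ / 2, min δ₁ δ₂, by positivity, by linarith⟩
  set ψ : EuclideanSpace ℝ (Fin n) → ℝ := φ.normed volume with hψ_def
  have hψcont : Continuous ψ := φ.continuous_normed
  have hψli : LocallyIntegrable ψ volume := hψcont.locallyIntegrable
  -- Step C: the mollification `ψ ⋆ f` and `ψ ⋆ Df` are `ε/4`-close to `f`, `Df`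
  have hFf : ∀ x, dist ((ψ ⋆[lsmul ℝ ℝ, volume] f) x) (f x) ≤ ε / 4 := fun x =>
    φ.dist_normed_convolution_le hfcont.aestronglyMeasurable fun y hy =>
      (h₁ (lt_of_lt_of_le (mem_ball.1 hy) (min_le_left _ _))).le
  have hFD : ∀ x, dist ((ψ ⋆[lsmul ℝ ℝ, volume] Df) x) (Df x) ≤ ε / 4 := fun x =>
    φ.dist_normed_convolution_le hDfcont.aestronglyMeasurable fun y hy =>
      (h₂ (lt_of_lt_of_le (mem_ball.1 hy) (min_le_right _ _))).le
  -- Step D: a ball containing every `t` with `x ∈ K`, `x - t ∈ tsupport f`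
  obtain ⟨R₁, hR₁⟩ := hK.isBounded.subset_closedBall (0 : EuclideanSpace ℝ (Fin n))
  obtain ⟨R₂, hR₂⟩ := hfc.isCompact.isBounded.subset_closedBall (0 : EuclideanSpace ℝ (Fin n))
  set D : Set (EuclideanSpace ℝ (Fin n)) := closedBall 0 (|R₁| + |R₂|) with hD_def
  have hD : IsCompact D := isCompact_closedBall _ _
  have hmemD : ∀ x ∈ K, ∀ t, x - t ∈ tsupport f → t ∈ D := by
    intro x hx t ht
    have hx' : ‖x‖ ≤ |R₁| := (mem_closedBall_zero_iff.1 (hR₁ hx)).trans (le_abs_self _)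
    have ht' : ‖x - t‖ ≤ |R₂| := (mem_closedBall_zero_iff.1 (hR₂ ht)).trans (le_abs_self _)
    rw [hD_def, mem_closedBall_zero_iff]
    calc ‖t‖ = ‖x - (x - t)‖ := by rw [sub_sub_cancel]
      _ ≤ ‖x‖ + ‖x - t‖ := norm_sub_le _ _
      _ ≤ |R₁| + |R₂| := add_le_add hx' ht'
  -- Step E: the tolerance `η` for the kernel
  set Cf : ℝ := ∫ t, ‖f t‖ with hCf_def
  set CD : ℝ := ∫ t, ‖Df t‖ with hCD_def
  have hCf0 : 0 ≤ Cf := integral_nonneg fun t => norm_nonneg _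
  have hCD0 : 0 ≤ CD := integral_nonneg fun t => norm_nonneg _
  set η : ℝ := ε / (4 * (Cf + CD + 1)) with hη_def
  have hη : 0 < η := by positivity
  have hη' : η * (Cf + CD + 1) = ε / 4 := by
    rw [hη_def]; field_simp
  have hηCf : η * Cf ≤ ε / 4 := by
    rw [← hη']; exact mul_le_mul_of_nonneg_left (by linarith) hη.le
  have hηCD : η * CD ≤ ε / 4 := by
    rw [← hη']; exact mul_le_mul_of_nonneg_left (by linarith) hη.le
  -- Step F: a polynomial kernel `η`-close to the bump on `D`
  obtain ⟨k, hk⟩ := exists_mvPolynomial_abs_sub_lt hD hψcont hη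
  set kf : EuclideanSpace ℝ (Fin n) → ℝ := fun t => eval (WithLp.ofLp t) k with hkf_def
  have hkcont : Continuous kf := (contDiff_mvPolynomial_eval_ofLp k (N := 0)).continuous
  have hkli : LocallyIntegrable kf volume := hkcont.locallyIntegrable
  have hker : ∀ x ∈ K, ∀ t, x - t ∈ tsupport f → |kf t - ψ t| ≤ η := fun x hx t ht =>
    (hk t (hmemD x hx t ht)).le
  -- Step G: `kf ⋆ f` is a polynomial, `ε/4`-close to `ψ ⋆ f` together with its derivative on `K`
  have hP' : ∀ x, HasFDerivAt (kf ⋆[lsmul ℝ ℝ, volume] f) ((kf ⋆[lsmul ℝ ℝ, volume] Df) x) x := by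
    intro x
    have := hfc.hasFDerivAt_convolution_right (lsmul ℝ ℝ) hkli hf x
    rwa [precompR_lsmul_eq] at this
  have hPF : ∀ x ∈ K,
      dist ((kf ⋆[lsmul ℝ ℝ, volume] f) x) ((ψ ⋆[lsmul ℝ ℝ, volume] f) x) ≤ ε / 4 :=
    fun x hx => (dist_convolution_le_of_kernel hkcont hψcont hfcont hfc subset_closure
      (hker x hx)).trans hηCf
  have hPFD : ∀ x ∈ K,
      dist ((kf ⋆[lsmul ℝ ℝ, volume] Df) x) ((ψ ⋆[lsmul ℝ ℝ, volume] Df) x) ≤ ε / 4 :=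
    fun x hx => (dist_convolution_le_of_kernel hkcont hψcont hDfcont hDfc
      (support_fderiv_subset ℝ) (hker x hx)).trans hηCD
  obtain ⟨p, hp⟩ := exists_mvPolynomial_convolution_eq k hfcont hfc
  have hpf :
      (fun y : EuclideanSpace ℝ (Fin n) => eval (WithLp.ofLp y) p) = kf ⋆[lsmul ℝ ℝ, volume] f :=
    funext fun y => (hp y).symm
  refine ⟨p, fun x hx => ?_, fun x hx => ?_⟩
  · rw [← hp x, ← Real.dist_eq]
    calc dist ((kf ⋆[lsmul ℝ ℝ, volume] f) x) (f x)
        ≤ dist ((kf ⋆[lsmul ℝ ℝ, volume] f) x) ((ψ ⋆[lsmul ℝ ℝ, volume] f) x) +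
          dist ((ψ ⋆[lsmul ℝ ℝ, volume] f) x) (f x) := dist_triangle _ _ _
      _ ≤ ε / 4 + ε / 4 := add_le_add (hPF x hx) (hFf x)
      _ < ε := by linarith
  · rw [hpf, (hP' x).fderiv, ← dist_eq_norm]
    calc dist ((kf ⋆[lsmul ℝ ℝ, volume] Df) x) (Df x)
        ≤ dist ((kf ⋆[lsmul ℝ ℝ, volume] Df) x) ((ψ ⋆[lsmul ℝ ℝ, volume] Df) x) +
          dist ((ψ ⋆[lsmul ℝ ℝ, volume] Df) x) (Df x) := dist_triangle _ _ _
      _ ≤ ε / 4 + ε / 4 := add_le_add (hPFD x hx) (hFD x)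
      _ < ε := by linarith

/-- **Weierstrass approximation with first derivatives** (Akbulut–King, Ch. II, Lemma 2.8.1 (a)
for `V = ℝⁿ`, `L = P = ∅`, order `1`): for a `C¹` function `f : ℝⁿ → ℝ`, a compact `K ⊆ ℝⁿ` and
`ε > 0` there is a polynomial `p` with `|p(x) - f(x)| < ε` and `‖Dp(x) - Df(x)‖ < ε` on `K`
(cut `f` off by a bump equal to `1` on a ball around `K` and apply the compactly supported case).
[cite: AkbulutKing1992, Ch. II Lemma 2.8.1 (a) (V = ℝⁿ, L = P = ∅, order 1)] -/
theorem exists_mvPolynomial_close_C1_of_contDiff {f : EuclideanSpace ℝ (Fin n) → ℝ}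
    (hf : ContDiff ℝ 1 f) {K : Set (EuclideanSpace ℝ (Fin n))} (hK : IsCompact K) {ε : ℝ}
    (hε : 0 < ε) :
    ∃ p : MvPolynomial (Fin n) ℝ,
      (∀ x ∈ K, |eval (WithLp.ofLp x) p - f x| < ε) ∧
      ∀ x ∈ K, ‖fderiv ℝ (fun y : EuclideanSpace ℝ (Fin n) => eval (WithLp.ofLp y) p) x -
        fderiv ℝ f x‖ < ε := by
  obtain ⟨R, hR⟩ := hK.isBounded.subset_closedBall (0 : EuclideanSpace ℝ (Fin n))
  let χ : ContDiffBump (0 : EuclideanSpace ℝ (Fin n)) :=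
    ⟨|R| + 1, |R| + 2, by positivity, by linarith⟩
  set g : EuclideanSpace ℝ (Fin n) → ℝ := fun x => χ x * f x with hg_def
  have hg : ContDiff ℝ 1 g := χ.contDiff.mul hf
  have hgc : HasCompactSupport g := χ.hasCompactSupport.mul_right
  have hball : ∀ x ∈ K, ball (0 : EuclideanSpace ℝ (Fin n)) (|R| + 1) ∈ 𝓝 x := fun x hx =>
    isOpen_ball.mem_nhds (mem_ball_zero_iff.2
      ((mem_closedBall_zero_iff.1 (hR hx)).trans_lt (by linarith [le_abs_self R])))
  have heq : ∀ x ∈ K, g =ᶠ[𝓝 x] f := fun x hx => by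
    filter_upwards [hball x hx] with y hy
    rw [hg_def]
    simp only
    rw [χ.one_of_mem_closedBall (ball_subset_closedBall hy), one_mul]
  obtain ⟨p, hp1, hp2⟩ := exists_mvPolynomial_close_C1 hg hgc hK hε
  refine ⟨p, fun x hx => ?_, fun x hx => ?_⟩
  · rw [← (heq x hx).self_of_nhds]; exact hp1 x hx
  · rw [← (heq x hx).fderiv_eq]; exact hp2 x hx

end Literature.Topology.FourManifolds
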